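import Summits.QuantumFields.YangMills.Theorems.AlphaInputsT3ACv3TransfiniteFill
import Summits.QuantumFields.YangMills.Theorems.AlphaInputsT3ACv3ModelBox
import HarnessLib

/-!
# `AlphaInputsT3ACv3TransfiniteFillBox` — row (S4) of the 19936 (FL) START v3 IN THE CARRIERS OF RECORD: the Coons fill `…v3TransfiniteFill` (corner-anchored cube `{0,…,2R}³`)
# transported to ★w1-19936 g2 LEAD's centred MODEL BOX `ModelBox.InBox R` (`|u_i| ≤ R`, p597788) — `fillB R A u μ`, EXACT on `ModelBox.BdryBond`, `‖fillB‖ ≤ 3a` on `BondInBox`,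
# ★★ `‖curlB (fillB R A) u μ ν‖ ≤ b + 4a∕R` on `PlaqInBox` from `‖curlB A‖ ≤ b` on `BdryPlaq` and `‖A‖ ≤ a` on `BdryBond` — reading ONLY boundary-bond values of `A` (`fillB_congr`) —
# cell `ym3-torus`, width seat `ym-ust-19936-w3` (g0); ★★OWNER g25 02:28:32Z ∕ 02:30:53Z (carrier file of record = LEAD's `…ModelBox`)

WHY (memo `NONABELIAN-FL-START-w1-g2.md` §3 (B); LEAD bus 2026-08-28T02:22:38Z «(S4) ★w3: `fill R A∂` with (i) `fill = A∂` on boundary bonds, (ii) `|fill u μ| ≤ 3·sup_∂|A∂|` on box bonds,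
(iii) `|curlB (fill R A∂) u μ ν| ≤ C·(sup_{∂ plaq}|curlB A∂| + sup_{∂ bonds}|A∂|∕R)` on box plaquettes (only the values of A∂ on boundary bonds may be read)»).  THIS FILE is exactly that, with
`C = 4` in the second slot and `1` in the first, for values in ANY real normed space (`ℝ`, `M_n(ℂ)`, `𝔰𝔲(n)`):
* §1 `fill_congr` — LOCALITY of the cube fill: `fill N A x μ` reads `A` only on boundary bonds `(y, μ)` of the box at the level `y_μ = x_μ`.
* §2 box letters LEAD's file does not carry (ns `ModelBox`, d-generic): `inBox_update`, `update_add_e`, `PlaqInBox.bondInBox`, `plaqInBox_update`, ★`bdryPlaq_update` (projection of a box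
  plaquette onto a face `{u_l = ±R}` is a boundary plaquette), `BdryPlaq.bdryBond` (its four bonds are boundary bonds).
* §3 the translation `toCube R u := u + R·𝟙`, `fromCube`, and their bookkeeping against `setc`∕`bump`∕`e`.
* §4 `fillB R A u μ := fill (2R) (A ∘ fromCube) (toCube u) μ`; ★`fillB_eq_of_bdryBond`; `fillB_mem`; `fillB_congr` (only `BdryBond` values read); the truncated datum `trunc`;
  ★`norm_fillB_le` (`≤ 3a` on `BondInBox`); `curlB_fillB` ∕ `dcurl_fromCube` (dictionary `curlB ↔ dcurl`); ★★`norm_curlB_fillB_le` (`≤ b + 4a∕R` on `PlaqInBox`, `μ ≠ ν`); the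
  `ℝ`-valued readings `abs_fillB_le`, `abs_curlB_fillB_le`.
HONEST FRAMING.  Lattice bookkeeping on a model cube; nothing of [Balaban1985UV3]∕[Balaban1985Variational]∕[Balaban1985Averaging] is asserted; the START, (FL)∕`hLift`, the stub 2′χ,
the crux `HistoryTailL` and any gap are NOT claimed; count-neutral helper (`--supports stmt-QuantumFields-19936`); registry untouched.  YM₃ on the three-torus is a RUNG of the
programme, not the Clay problem; nothing here is about d = 4, infinite volume or a mass gap.

References: S. A. Coons, MIT MAC-TR-41 (1967) [folklore: the bilinearly blended patch]; T. Bałaban, Commun. Math. Phys. 102 (1985) 277–309 [Balaban1985Variational] ((8), (11)–(13)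
pp.279–280).
-/

set_option autoImplicit false

noncomputable section

namespace Summit.QuantumFields.YangMills.Theorems

/-! ## §1 Locality of the cube fill -/

namespace TransfiniteFill

/-- **LOCALITY OF THE FILL**: `fill N A x μ` (for `x` in the cube) reads the datum only on BOUNDARY bonds `(y, μ)` of the cube with `y` in the cube at the level `y_μ = x_μ` — two data
agreeing there have the same fill. [folklore] -/
theorem fill_congr {V : Type*} [AddCommGroup V] [Module ℝ V] (N : ℕ) {A A' : (Fin 3 → ℤ) → Fin 3 → V} {x : Fin 3 → ℤ} (hx : InBox N x) {μ : Fin 3}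
    (h : ∀ y, InBox N y → BdryBond N y μ → y μ = x μ → A y μ = A' y μ) : fill N A x μ = fill N A' x μ := by
  have hN0 : (0 : ℤ) ≤ N := by exact_mod_cast Nat.zero_le N
  have hν : tA μ ≠ μ := tA_ne μ
  have hl : tB μ ≠ μ := tB_ne μ
  have hνl : tA μ ≠ tB μ := tA_ne_tB μ
  have h1 : ∀ (i : Fin 3), i ≠ μ → ∀ v : ℤ, (v = 0 ∨ v = N) → A (setc x i v) μ = A' (setc x i v) μ := fun i hi v hv => by
    rcases hv with rfl | rfl
    · exact h _ (inBox_setc hx i le_rfl hN0) (bdry_setc_zero N x hi) (setc_apply_ne x hi.symm 0)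
    · exact h _ (inBox_setc hx i hN0 le_rfl) (bdry_setc_top N x hi) (setc_apply_ne x hi.symm _)
  have h2 : ∀ v w : ℤ, (v = 0 ∨ v = N) → (w = 0 ∨ w = N) → A (setc (setc x (tA μ) v) (tB μ) w) μ = A' (setc (setc x (tA μ) v) (tB μ) w) μ :=
    fun v w hv hw => by
    have hvb : InBox N (setc x (tA μ) v) := by rcases hv with rfl | rfl <;> [exact inBox_setc hx _ le_rfl hN0; exact inBox_setc hx _ hN0 le_rfl]
    have hwb : InBox N (setc (setc x (tA μ) v) (tB μ) w) := by
      rcases hw with rfl | rfl <;> [exact inBox_setc hvb _ le_rfl hN0; exact inBox_setc hvb _ hN0 le_rfl]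
    refine h _ hwb (bdry_setc_setc_inner N x hν hνl hv w) ?_
    rw [setc_apply_ne _ hl.symm, setc_apply_ne _ hν.symm]
  unfold fill coons
  rw [h1 _ hν 0 (Or.inl rfl), h1 _ hν N (Or.inr rfl), h1 _ hl 0 (Or.inl rfl), h1 _ hl N (Or.inr rfl), h2 0 0 (Or.inl rfl) (Or.inl rfl),
    h2 0 N (Or.inl rfl) (Or.inr rfl), h2 N 0 (Or.inr rfl) (Or.inl rfl), h2 N N (Or.inr rfl) (Or.inr rfl)]

end TransfiniteFill

/-! ## §2 Box letters (d-generic) -/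

namespace ModelBox

variable {d : ℕ}

/-- Resetting one coordinate to a value of modulus `≤ R` stays in the box. [folklore] -/
theorem inBox_update {R : ℕ} {u : Fin d → ℤ} (h : InBox R u) (l : Fin d) {s : ℤ} (hs : |s| ≤ (R : ℤ)) : InBox R (Function.update u l s) := by
  intro i; by_cases hi : i = l
  · subst hi; simpa using hs
  · rw [Function.update_of_ne hi]; exact h i

/-- Resetting a coordinate other than `μ` commutes with the step `+ e_μ`. [folklore] -/
theorem update_add_e (u : Fin d → ℤ) {l μ : Fin d} (h : l ≠ μ) (s : ℤ) : Function.update u l s + e μ = Function.update (u + e μ) l s := by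
  funext i; by_cases hi : i = l
  · subst hi; simp [e_apply_ne h]
  · simp [hi]

/-- The four bonds of a box plaquette are box bonds. [folklore] -/
theorem PlaqInBox.bondInBox {R : ℕ} {u : Fin d → ℤ} {μ ν : Fin d} (h : PlaqInBox R u μ ν) :
    BondInBox R u μ ∧ BondInBox R (u + e μ) ν ∧ BondInBox R (u + e ν) μ ∧ BondInBox R u ν := by
  refine ⟨⟨h.1, h.2.1⟩, ⟨h.2.1, h.2.2.2⟩, ⟨h.2.2.1, ?_⟩, ⟨h.1, h.2.2.1⟩⟩
  rw [← add_e_comm]; exact h.2.2.2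

/-- Resetting a coordinate outside `{μ, ν}` to a value of modulus `≤ R` keeps a box plaquette in the box. [folklore] -/
theorem plaqInBox_update {R : ℕ} {u : Fin d → ℤ} {μ ν l : Fin d} (h : PlaqInBox R u μ ν) (hlμ : l ≠ μ) (hlν : l ≠ ν) {s : ℤ} (hs : |s| ≤ (R : ℤ)) :
    PlaqInBox R (Function.update u l s) μ ν := by
  refine ⟨inBox_update h.1 l hs, ?_, ?_, ?_⟩
  · rw [update_add_e u hlμ]; exact inBox_update h.2.1 l hs
  · rw [update_add_e u hlν]; exact inBox_update h.2.2.1 l hs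
  · rw [update_add_e u hlμ, update_add_e _ hlν]; exact inBox_update h.2.2.2 l hs

/-- **★ PROJECTION ONTO A FACE**: resetting a coordinate outside `{μ, ν}` to `±R` sends a box plaquette to a BOUNDARY plaquette. [folklore] -/
theorem bdryPlaq_update {R : ℕ} {u : Fin d → ℤ} {μ ν l : Fin d} (h : PlaqInBox R u μ ν) (hlμ : l ≠ μ) (hlν : l ≠ ν) {s : ℤ} (hs : |s| = (R : ℤ)) :
    BdryPlaq R (Function.update u l s) μ ν :=
  ⟨plaqInBox_update h hlμ hlν hs.le, l, hlμ, hlν, by simpa using hs⟩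

/-- The four bonds of a boundary plaquette are boundary bonds. [folklore] -/
theorem BdryPlaq.bdryBond {R : ℕ} {u : Fin d → ℤ} {μ ν : Fin d} (h : BdryPlaq R u μ ν) :
    BdryBond R u μ ∧ BdryBond R (u + e μ) ν ∧ BdryBond R (u + e ν) μ ∧ BdryBond R u ν := by
  obtain ⟨hP, i, hiμ, hiν, hi⟩ := h
  obtain ⟨b1, b2, b3, b4⟩ := hP.bondInBox
  exact ⟨⟨b1, i, hiμ, hi⟩, ⟨b2, i, hiν, by rwa [add_e_apply_ne u hiμ]⟩, ⟨b3, i, hiμ, by rwa [add_e_apply_ne u hiν]⟩, ⟨b4, i, hiν, hi⟩⟩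

/-- **THE CRUDE BOUND**: `‖curl a‖ ≤` the sum of the four bond norms. [folklore] -/
theorem norm_curlB_le {V : Type*} [SeminormedAddCommGroup V] (a : (Fin d → ℤ) → Fin d → V) (u : Fin d → ℤ) (μ ν : Fin d) :
    ‖curlB a u μ ν‖ ≤ ‖a u μ‖ + ‖a (u + e μ) ν‖ + ‖a (u + e ν) μ‖ + ‖a u ν‖ := by
  rw [curlB_def]
  exact (norm_sub_le _ _).trans (add_le_add ((norm_sub_le _ _).trans (add_le_add (norm_add_le _ _) le_rfl)) le_rfl)

/-- In dimension `3` two distinct directions have a third. [folklore] -/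
theorem exists_third (μ ν : Fin 3) (h : μ ≠ ν) : ∃ l : Fin 3, l ≠ μ ∧ l ≠ ν := by
  revert μ ν; decide

end ModelBox

/-! ## §3 The translation between the centred box and the corner-anchored cube -/

namespace TransfiniteFill

open ModelBox (e curlB curlB_def InBox.bounds add_e_apply_same add_e_apply_ne)

/-- The translation `u ↦ u + R·𝟙` from the centred box `[-R, R]³` onto the cube `{0,…,2R}³`. [folklore] -/
def toCube (R : ℕ) (u : Fin 3 → ℤ) : Fin 3 → ℤ := fun i => u i + R

/-- Its inverse `y ↦ y − R·𝟙`. [folklore] -/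
def fromCube (R : ℕ) (y : Fin 3 → ℤ) : Fin 3 → ℤ := fun i => y i - R

/-- `toCube` coordinatewise. [folklore] -/
@[simp] theorem toCube_apply (R : ℕ) (u : Fin 3 → ℤ) (i : Fin 3) : toCube R u i = u i + R := rfl

/-- `fromCube` coordinatewise. [folklore] -/
@[simp] theorem fromCube_apply (R : ℕ) (y : Fin 3 → ℤ) (i : Fin 3) : fromCube R y i = y i - R := rfl

/-- `fromCube ∘ toCube = id`. [folklore] -/
@[simp] theorem fromCube_toCube (R : ℕ) (u : Fin 3 → ℤ) : fromCube R (toCube R u) = u := by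
  funext i; simp

/-- `toCube ∘ fromCube = id`. [folklore] -/
@[simp] theorem toCube_fromCube (R : ℕ) (y : Fin 3 → ℤ) : toCube R (fromCube R y) = y := by
  funext i; simp

/-- A unit step is a `bump` after translation. [folklore] -/
theorem toCube_add_e (R : ℕ) (u : Fin 3 → ℤ) (μ : Fin 3) : toCube R (u + e μ) = bump (toCube R u) μ := by
  funext i; by_cases hi : i = μ
  · subst hi; rw [toCube_apply, bump_apply_same, toCube_apply, add_e_apply_same]; ring
  · rw [toCube_apply, bump_apply_ne _ hi, toCube_apply, add_e_apply_ne u hi]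

/-- … and back. [folklore] -/
theorem fromCube_bump_toCube (R : ℕ) (u : Fin 3 → ℤ) (μ : Fin 3) : fromCube R (bump (toCube R u) μ) = u + e μ := by
  rw [← toCube_add_e, fromCube_toCube]

/-- The face `{y_l = 0}` of the cube is the face `{u_l = −R}` of the box. [folklore] -/
theorem setc_toCube_zero (R : ℕ) (u : Fin 3 → ℤ) (l : Fin 3) : setc (toCube R u) l 0 = toCube R (Function.update u l (-(R : ℤ))) := by
  funext i; by_cases hi : i = l
  · subst hi; simp [setc]
  · simp [setc, hi]

/-- The face `{y_l = 2R}` of the cube is the face `{u_l = R}` of the box. [folklore] -/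
theorem setc_toCube_top (R : ℕ) (u : Fin 3 → ℤ) (l : Fin 3) : setc (toCube R u) l ((2 * R : ℕ) : ℤ) = toCube R (Function.update u l (R : ℤ)) := by
  funext i; by_cases hi : i = l
  · subst hi; simp [setc]; ring
  · simp [setc, hi]

/-- The box goes into the cube. [folklore] -/
theorem inBox_toCube {R : ℕ} {u : Fin 3 → ℤ} (h : ModelBox.InBox R u) : InBox (2 * R) (toCube R u) := by
  intro i
  have := h.bounds i
  rw [toCube_apply]; push_cast
  constructor <;> linarith [this.1, this.2]

/-- **THE BOUNDARY DICTIONARY**: a bond of the cube which is (cube-)boundary, in the cube, and at the `μ`-level of a BOX bond `(u, μ)` is, read back in the box, a boundary bond in LEAD's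
sense (`ModelBox.BdryBond`: both ends in the box, in a face). [folklore] -/
theorem bdryBond_fromCube {R : ℕ} {u : Fin 3 → ℤ} {μ : Fin 3} (hu : ModelBox.BondInBox R u μ) {y : Fin 3 → ℤ} (hy : InBox (2 * R) y) (hb : BdryBond (2 * R) y μ)
    (hl : y μ = toCube R u μ) : ModelBox.BdryBond R (fromCube R y) μ := by
  have hy' : ∀ i, -(R : ℤ) ≤ y i - R ∧ y i - R ≤ R := fun i => by
    have := hy i; push_cast at this; constructor <;> linarith [this.1, this.2]
  refine ⟨⟨fun i => abs_le.mpr (by simpa using hy' i), fun i => ?_⟩, ?_⟩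
  · by_cases hi : i = μ
    · subst hi
      have h2 := hu.2 i
      rw [add_e_apply_same] at h2 ⊢
      rw [fromCube_apply, hl, toCube_apply]
      simpa using h2
    · rw [add_e_apply_ne _ hi]; exact abs_le.mpr (by simpa using hy' i)
  · obtain ⟨i, hi, h0⟩ := hb
    refine ⟨i, hi, ?_⟩
    rw [fromCube_apply]
    rcases h0 with h0 | h0
    · rw [h0, zero_sub, abs_neg]; exact abs_of_nonneg (by positivity)
    · rw [h0]; push_cast; rw [show (2 : ℤ) * R - R = R by ring]; exact abs_of_nonneg (by positivity)

/-! ## §4 The fill on the model box -/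

section Algebra

variable {V : Type*} [AddCommGroup V] [Module ℝ V]

/-- **THE COONS FILL ON THE MODEL BOX** of half-side `R`: the cube fill of side `2R` of the translated datum, translated back. [folklore] -/
def fillB (R : ℕ) (A : (Fin 3 → ℤ) → Fin 3 → V) (u : Fin 3 → ℤ) (μ : Fin 3) : V := fill (2 * R) (fun y ν => A (fromCube R y) ν) (toCube R u) μ

/-- The definition unfolded. [folklore] -/
theorem fillB_def (R : ℕ) (A : (Fin 3 → ℤ) → Fin 3 → V) (u : Fin 3 → ℤ) (μ : Fin 3) :
    fillB R A u μ = fill (2 * R) (fun y ν => A (fromCube R y) ν) (toCube R u) μ := rfl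

/-- **EXACT IN EVERY FACE**: on a bond `(u, μ)` with some coordinate `i ≠ μ` of modulus `R` the fill IS the datum (no box hypothesis needed). [folklore] -/
theorem fillB_eq_of_face {R : ℕ} (hR : R ≠ 0) (A : (Fin 3 → ℤ) → Fin 3 → V) {u : Fin 3 → ℤ} {μ : Fin 3} (h : ∃ i, i ≠ μ ∧ |u i| = (R : ℤ)) :
    fillB R A u μ = A u μ := by
  obtain ⟨i, hi, hui⟩ := h
  have hb : BdryBond (2 * R) (toCube R u) μ := by
    refine ⟨i, hi, ?_⟩
    rw [toCube_apply]
    rcases (abs_eq (by positivity : (0 : ℤ) ≤ R)).mp hui with h | h <;> rw [h] <;> push_cast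
    · right; ring
    · left; ring
  rw [fillB_def, fill_eq_of_bdry (by omega) _ hb]
  simp only [fromCube_toCube]

/-- **★ (i) EXACT ON BOUNDARY BONDS** (LEAD's `ModelBox.BdryBond`). [folklore] -/
theorem fillB_eq_of_bdryBond {R : ℕ} (hR : R ≠ 0) (A : (Fin 3 → ℤ) → Fin 3 → V) {u : Fin 3 → ℤ} {μ : Fin 3} (h : ModelBox.BdryBond R u μ) :
    fillB R A u μ = A u μ :=
  fillB_eq_of_face hR A h.2

/-- **VALUES IN A SUBMODULE** (`𝔰𝔲(n)`-valuedness). [folklore] -/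
theorem fillB_mem (R : ℕ) (S : Submodule ℝ V) {A : (Fin 3 → ℤ) → Fin 3 → V} (hA : ∀ v ν, A v ν ∈ S) (u : Fin 3 → ℤ) (μ : Fin 3) : fillB R A u μ ∈ S :=
  fill_mem _ S (fun _ _ => hA _ _) _ _

/-- **ONLY BOUNDARY-BOND VALUES ARE READ**: on a box bond, two data agreeing on LEAD's boundary bonds have the same fill. [folklore] -/
theorem fillB_congr (R : ℕ) {A A' : (Fin 3 → ℤ) → Fin 3 → V} (h : ∀ v ν, ModelBox.BdryBond R v ν → A v ν = A' v ν) {u : Fin 3 → ℤ} {μ : Fin 3}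
    (hu : ModelBox.BondInBox R u μ) : fillB R A u μ = fillB R A' u μ :=
  fill_congr (2 * R) (inBox_toCube hu.1) fun _ hy hb hl => h _ _ (bdryBond_fromCube hu hy hb hl)

open scoped Classical in
/-- The datum TRUNCATED to LEAD's boundary bonds (zero elsewhere) — the device carrying hypotheses stated on boundary bonds only through the cube theorems. [folklore] -/
def trunc (R : ℕ) (A : (Fin 3 → ℤ) → Fin 3 → V) (v : Fin 3 → ℤ) (ν : Fin 3) : V := if ModelBox.BdryBond R v ν then A v ν else 0

omit [Module ℝ V] in
/-- On boundary bonds the truncation is the datum. [folklore] -/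
theorem trunc_of_bdry {R : ℕ} {A : (Fin 3 → ℤ) → Fin 3 → V} {v : Fin 3 → ℤ} {ν : Fin 3} (h : ModelBox.BdryBond R v ν) : trunc R A v ν = A v ν := by
  unfold trunc; exact if_pos h

/-- The fill of the truncated datum is the fill, on box bonds. [folklore] -/
theorem fillB_trunc (R : ℕ) (A : (Fin 3 → ℤ) → Fin 3 → V) {u : Fin 3 → ℤ} {μ : Fin 3} (hu : ModelBox.BondInBox R u μ) : fillB R (trunc R A) u μ = fillB R A u μ :=
  fillB_congr R (fun _ _ h => trunc_of_bdry h) hu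

omit [Module ℝ V] in
/-- On a boundary plaquette the truncated datum has the curl of the datum. [folklore] -/
theorem curlB_trunc {R : ℕ} (A : (Fin 3 → ℤ) → Fin 3 → V) {v : Fin 3 → ℤ} {μ ν : Fin 3} (h : ModelBox.BdryPlaq R v μ ν) : curlB (trunc R A) v μ ν = curlB A v μ ν := by
  obtain ⟨h1, h2, h3, h4⟩ := h.bdryBond
  simp only [curlB_def, trunc_of_bdry h1, trunc_of_bdry h2, trunc_of_bdry h3, trunc_of_bdry h4]

end Algebra

section Norms

variable {V : Type*} [NormedAddCommGroup V] [NormedSpace ℝ V]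

omit [NormedSpace ℝ V] in
/-- The dictionary `dcurl ∘ toCube = curlB` (the cube curl `dcurl` of `…v3TransfiniteFill` lives over normed carriers). [folklore] -/
theorem dcurl_fromCube (R : ℕ) (B : (Fin 3 → ℤ) → Fin 3 → V) (v : Fin 3 → ℤ) (μ ν : Fin 3) :
    dcurl (fun y κ => B (fromCube R y) κ) (toCube R v) μ ν = curlB B v μ ν := by
  simp only [dcurl, curlB_def, fromCube_toCube, fromCube_bump_toCube]

/-- The dictionary `curlB (fillB R A) = dcurl (fill (2R) (A ∘ fromCube)) ∘ toCube`. [folklore] -/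
theorem curlB_fillB (R : ℕ) (A : (Fin 3 → ℤ) → Fin 3 → V) (u : Fin 3 → ℤ) (μ ν : Fin 3) :
    curlB (fillB R A) u μ ν = dcurl (fill (2 * R) (fun y κ => A (fromCube R y) κ)) (toCube R u) μ ν := by
  simp only [curlB_def, dcurl, fillB_def, toCube_add_e]

omit [NormedSpace ℝ V] in
/-- The truncated datum is bounded everywhere by the boundary bound. [folklore] -/
theorem norm_trunc_le {R : ℕ} {A : (Fin 3 → ℤ) → Fin 3 → V} {a : ℝ} (ha : 0 ≤ a) (hA : ∀ v ν, ModelBox.BdryBond R v ν → ‖A v ν‖ ≤ a) (v : Fin 3 → ℤ) (ν : Fin 3) :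
    ‖trunc R A v ν‖ ≤ a := by
  unfold trunc; split_ifs with h
  · exact hA v ν h
  · simpa using ha

/-- **★ (ii) THE SUP BOUND ON BOX BONDS**: `‖fillB R A u μ‖ ≤ 3·a` from `‖A‖ ≤ a` on LEAD's boundary bonds. [folklore] -/
theorem norm_fillB_le {R : ℕ} (hR : R ≠ 0) (A : (Fin 3 → ℤ) → Fin 3 → V) {a : ℝ} (ha : 0 ≤ a) (hA : ∀ v ν, ModelBox.BdryBond R v ν → ‖A v ν‖ ≤ a)
    {u : Fin 3 → ℤ} {μ : Fin 3} (hu : ModelBox.BondInBox R u μ) : ‖fillB R A u μ‖ ≤ 3 * a := by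
  rw [← fillB_trunc R A hu, fillB_def]
  exact norm_fill_le (by omega) _ (fun y ν _ _ => norm_trunc_le ha hA _ _) (inBox_toCube hu.1) μ

/-- **★★ (iii) THE CURL BOUND ON BOX PLAQUETTES**: `‖curlB (fillB R A) u μ ν‖ ≤ b + 4·a∕R` (`μ ≠ ν`, the plaquette in the box) from `‖curlB A‖ ≤ b` on LEAD's boundary plaquettes and
`‖A‖ ≤ a` on LEAD's boundary bonds — the memo's `C·(b + a∕R)`; only boundary-bond values of `A` are read. [folklore] -/
theorem norm_curlB_fillB_le {R : ℕ} (hR : R ≠ 0) (A : (Fin 3 → ℤ) → Fin 3 → V) {a b : ℝ} (ha : 0 ≤ a) (hA : ∀ v ν, ModelBox.BdryBond R v ν → ‖A v ν‖ ≤ a)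
    (hB : ∀ v μ ν, ModelBox.BdryPlaq R v μ ν → ‖curlB A v μ ν‖ ≤ b) {u : Fin 3 → ℤ} {μ ν : Fin 3} (hμν : μ ≠ ν) (hu : ModelBox.PlaqInBox R u μ ν) :
    ‖curlB (fillB R A) u μ ν‖ ≤ b + 4 * a / R := by
  obtain ⟨l, hlμ, hlν⟩ := ModelBox.exists_third μ ν hμν
  obtain ⟨h1, h2, h3, h4⟩ := hu.bondInBox
  -- pass to the truncated datum (same fill on the four box bonds of the plaquette)
  have hc : curlB (fillB R A) u μ ν = curlB (fillB R (trunc R A)) u μ ν := by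
    simp only [curlB_def, fillB_trunc R A h1, fillB_trunc R A h2, fillB_trunc R A h3, fillB_trunc R A h4]
  rw [hc, curlB_fillB]
  -- the two face plaquettes
  have key : ∀ s : ℤ, |s| = (R : ℤ) → ‖dcurl (fun y κ => trunc R A (fromCube R y) κ) (toCube R (Function.update u l s)) μ ν‖ ≤ b := fun s hs => by
    have hP : ModelBox.BdryPlaq R (Function.update u l s) μ ν := ModelBox.bdryPlaq_update hu hlμ hlν hs
    rw [dcurl_fromCube, curlB_trunc A hP]
    exact hB _ _ _ hP
  have hb0 : ‖dcurl (fun y κ => trunc R A (fromCube R y) κ) (setc (toCube R u) l 0) μ ν‖ ≤ b := by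
    rw [setc_toCube_zero]; exact key _ (by rw [abs_neg]; exact abs_of_nonneg (by positivity))
  have hbN : ‖dcurl (fun y κ => trunc R A (fromCube R y) κ) (setc (toCube R u) l ((2 * R : ℕ) : ℤ)) μ ν‖ ≤ b := by
    rw [setc_toCube_top]; exact key _ (abs_of_nonneg (by positivity))
  have hRr : (R : ℝ) ≠ 0 := by exact_mod_cast hR
  calc _ ≤ b + 8 * a / ((2 * R : ℕ) : ℝ) :=
        norm_dcurl_fill_le (by omega) _ (fun y κ _ _ => norm_trunc_le ha hA _ _) hμν (Ne.symm hlμ) (Ne.symm hlν) (inBox_toCube hu.1) hb0 hbN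
    _ = b + 4 * a / R := by push_cast; field_simp; ring

/-- (ii) for real-valued data, with `|·|`. [folklore] -/
theorem abs_fillB_le {R : ℕ} (hR : R ≠ 0) (A : (Fin 3 → ℤ) → Fin 3 → ℝ) {a : ℝ} (ha : 0 ≤ a) (hA : ∀ v ν, ModelBox.BdryBond R v ν → |A v ν| ≤ a)
    {u : Fin 3 → ℤ} {μ : Fin 3} (hu : ModelBox.BondInBox R u μ) : |fillB R A u μ| ≤ 3 * a := by
  rw [← Real.norm_eq_abs]; exact norm_fillB_le hR A ha (fun v ν h => by rw [Real.norm_eq_abs]; exact hA v ν h) hu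

/-- (iii) for real-valued data, with `|·|`. [folklore] -/
theorem abs_curlB_fillB_le {R : ℕ} (hR : R ≠ 0) (A : (Fin 3 → ℤ) → Fin 3 → ℝ) {a b : ℝ} (ha : 0 ≤ a) (hA : ∀ v ν, ModelBox.BdryBond R v ν → |A v ν| ≤ a)
    (hB : ∀ v μ ν, ModelBox.BdryPlaq R v μ ν → |curlB A v μ ν| ≤ b) {u : Fin 3 → ℤ} {μ ν : Fin 3} (hμν : μ ≠ ν) (hu : ModelBox.PlaqInBox R u μ ν) :
    |curlB (fillB R A) u μ ν| ≤ b + 4 * a / R := by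
  rw [← Real.norm_eq_abs]
  exact norm_curlB_fillB_le hR A ha (fun v ν h => by rw [Real.norm_eq_abs]; exact hA v ν h) (fun v μ ν h => by rw [Real.norm_eq_abs]; exact hB v μ ν h) hμν hu

end Norms

end TransfiniteFill

end Summit.QuantumFields.YangMills.Theorems

end
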